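import Mathlib
import HarnessLib
import Summits.ResolutionOfSingularities.ResolutionOfSingularities.Theorems.WildQuotientsWildQuotientResolutionJordanFiveChart0BrickGlue
import Summits.ResolutionOfSingularities.ResolutionOfSingularities.Theorems.WildQuotientsWildQuotientResolutionJordanFiveI12Stable

/-!
# RUNG V5 (`J₅`): the one-shot ring brick `H₀′` (μ₄ piece on `chart 0`) from a RING-SIDE statement in
# `B₀ = (k[x][I₁₂t])_{(x_a³t)}`

(crux stmt-ResolutionOfSingularities-15640 `WildQuotients.WildQuotientResolution`, line `Sketch`;
chain w45c RUNG V5 `JordanFive.jordanFive_hasResolution_of_bricks'` (p536385), brick `HP₀` one-shot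
(res-L1-w45c-plan-1 RULING v8.4-B β‴; assembler of `brickHP0'` = res-L1-w45c-stub-4 (C)); the `H₀`
binder below is the hypothesis `H₀` of this seat's `JordanFive.coneBrick_zero_of_ringBrick'`
(p536645) VERBATIM; chart-0 twin of res-D-pv-033 AS res-L1-w45c-stub-5's `brickH₁_of_ringSide`
(p537394) / `brickH₂_of_ringSide` (p537070). [OURS · L1 W4.5c] — assembly of landed decls; NOT a
statement of any manuscript (Hironaka 2017 is consumed nowhere). Prover res-L1-w45c-lead-1.
AI-written Lean, kernel-checked; weaker than expert review.)

`JordanFive.brickHP0'_of_ringSide`: the scheme-side one-shot brick `H₀′` follows from ANY ring-side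
brick in `B₀ = (k[x][I₁₂t])_{(x_a³t)}` of the shape: for every graded family `φ` with the coefficient
law, its powers clause `hP` at `s₀ = g₀t = x_a³t`, and all ratios `t_j` (`j ∉ {0,2,5,13}`), `t'_j`
(`j ≠ 0`) with `(g₀/1)·t_j = g_j/1`, `(g₀/1)·t'_j = g_j/1` — «`∃ R₀` noetherian, `J₀, J₀'` radical,
an injective `ψC : R₀ → B₀` onto the `φ`-fixed part with `√(ψC⁻¹⟨x_a/1,…,x_d/1, t_j⟩) = J₀`,
`√(ψC⁻¹⟨x_a/1,…,x_d/1, t'_j⟩) = J₀'`, and `Bl_{J₀·(J₀²:J₀')}(Spec R₀)` regular». PROOF = the seam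
`JordanFive.exists_sectionsEquiv_chart0_appLE` and ONE `exact BlowupExit.ringBrick_transport₂`
(both res-L1-w45c-stub-5 p536366). With it, (C) `brickHP0' := brickHP0'_of_ringSide … <Hring₀>` where
`Hring₀` is pure algebra: stub-2's `exists_ringBrick_X0_model` (p537855) ∘ this seat's (A1)
`exists_ringEquiv_blowupChart0_weightZero` (p538056) ∘ stub-2's (B) `chart0_seamFixed_iff` ∘
`ToricChart.isNoetherianRing_ring` (p535796) ∘ `Quarter1123.blowup_regular_mulColon`.
-/

-- single-problem summit: the doubled namespace component `ResolutionOfSingularities` is forced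
set_option linter.dupNamespace false

noncomputable section

open CategoryTheory AlgebraicGeometry TopologicalSpace MvPolynomial Polynomial HomogeneousLocalization
open Literature.AlgebraicGeometry.Resolution Literature.AlgebraicGeometry.RelativeSpec
open scoped Pointwise

namespace Summit.ResolutionOfSingularities.ResolutionOfSingularities.Theorems.WildQuotientResolution.JordanFive

-- the statement is the literal `H₀` binder of p536645 (large chart / quotient terms): head-room
set_option maxHeartbeats 8000000 in
/-- **`H₀′` from a ring side in `B₀ = (k[x][I₁₂t])_{(x_a³t)}`** (see the module docstring).
[OURS · L1 W4.5c] [folklore; assembly of landed decls] -/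
theorem brickHP0'_of_ringSide (p : ℕ) (_hp : p.Prime) (_hp5 : 5 ≤ p)
    (k : Type) [Field k] [CharP k p] (n : ℕ)
    (σ : MvPolynomial (Fin n) k ≃ₐ[k] MvPolynomial (Fin n) k) [Finite ↥(Subgroup.zpowers σ)]
    (a b c d e : Fin n) (hab : a ≠ b) (hac : a ≠ c) (had : a ≠ d) (hae : a ≠ e) (hbc : b ≠ c)
    (hbd : b ≠ d) (hcd : c ≠ d)
    (hb : σ (X b) = X b + X a) (hc : σ (X c) = X c + X b) (hd : σ (X d) = X d + X c)
    (hσ : ∀ i, i ≠ b → i ≠ c → i ≠ d → i ≠ e → σ (X i) = X i)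
    (Hring₀ : ∀ (φ : ↥(Subgroup.zpowers σ) →
        (reesGrading (I12 k n a b c d) →+*ᵍ reesGrading (I12 k n a b c d)))
      (_ : ∀ (g : ↥(Subgroup.zpowers σ)) x, ((φ g x : reesAlgebra (I12 k n a b c d)) :
          (MvPolynomial (Fin n) k)[X]) =
        (x : (MvPolynomial (Fin n) k)[X]).map ((MulSemiringAction.toRingEquiv
          (↥(Subgroup.zpowers σ)) (MvPolynomial (Fin n) k) g⁻¹ : _ ≃+* _) : _ →+* _))
      (hP : ∀ g, Submonoid.powers (reesT (gens12 k n a b c d 0) (gens12_mem_I12 k n a b c d 0)) ≤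
        (Submonoid.powers (reesT (gens12 k n a b c d 0) (gens12_mem_I12 k n a b c d 0))).comap (φ g))
      (t : {j : Fin 40 // j ≠ 0 ∧ j ≠ 2 ∧ j ≠ 5 ∧ j ≠ 13} →
        HomogeneousLocalization.Away (reesGrading (I12 k n a b c d))
          (reesT (gens12 k n a b c d 0) (gens12_mem_I12 k n a b c d 0)))
      (t' : {j : Fin 40 // j ≠ 0} →
        HomogeneousLocalization.Away (reesGrading (I12 k n a b c d))
          (reesT (gens12 k n a b c d 0) (gens12_mem_I12 k n a b c d 0)))
      (_ : ∀ j, ((fromZeroRingHom (reesGrading (I12 k n a b c d)) (.powers _)).comp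
          (reesGrading.zeroRingHom (I12 k n a b c d))) (gens12 k n a b c d 0) * t j =
        ((fromZeroRingHom (reesGrading (I12 k n a b c d)) (.powers _)).comp
          (reesGrading.zeroRingHom (I12 k n a b c d))) (gens12 k n a b c d j.1))
      (_ : ∀ j, ((fromZeroRingHom (reesGrading (I12 k n a b c d)) (.powers _)).comp
          (reesGrading.zeroRingHom (I12 k n a b c d))) (gens12 k n a b c d 0) * t' j =
        ((fromZeroRingHom (reesGrading (I12 k n a b c d)) (.powers _)).comp
          (reesGrading.zeroRingHom (I12 k n a b c d))) (gens12 k n a b c d j.1)),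
      ∃ (R₀ : Type) (_ : CommRing R₀) (_ : IsNoetherianRing R₀) (J₀ J₀' : Ideal R₀)
        (ψC : R₀ →+* HomogeneousLocalization.Away (reesGrading (I12 k n a b c d))
          (reesT (gens12 k n a b c d 0) (gens12_mem_I12 k n a b c d 0))),
        Function.Injective ψC ∧
        (∀ y, y ∈ Set.range ψC ↔ ∀ g, HomogeneousLocalization.map (φ g) (hP g) y = y) ∧
        J₀.IsRadical ∧ J₀'.IsRadical ∧
        ((Ideal.span (((fromZeroRingHom (reesGrading (I12 k n a b c d)) (.powers _)).comp
          (reesGrading.zeroRingHom (I12 k n a b c d))) '' {X a, X b, X c, X d} ∪ Set.range t)).comap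
          ψC).radical = J₀ ∧
        ((Ideal.span (((fromZeroRingHom (reesGrading (I12 k n a b c d)) (.powers _)).comp
          (reesGrading.zeroRingHom (I12 k n a b c d))) '' {X a, X b, X c, X d} ∪ Set.range t')).comap
          ψC).radical = J₀' ∧
        Scheme.IsRegular (affineBlowup (J₀ * (J₀ ^ 2).colon (J₀' : Set R₀)))) :
    ∀ (ρ : ↥(Subgroup.zpowers σ) →* Aut (Spec (CommRingCat.of (MvPolynomial (Fin n) k))))
      (hρ : ∀ g : ↥(Subgroup.zpowers σ), (ρ g).hom = Spec.map (CommRingCat.ofHom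
        ((MulSemiringAction.toRingEquiv (↥(Subgroup.zpowers σ)) (MvPolynomial (Fin n) k) g⁻¹ :
          MvPolynomial (Fin n) k ≃+* MvPolynomial (Fin n) k) :
            MvPolynomial (Fin n) k →+* MvPolynomial (Fin n) k)))
      (ρB : ActionOver
        (affineBlowup.π (I12 k n a b c d) ≫
          Spec.map (CommRingCat.ofHom (algebraMap
            (FixedPoints.subalgebra k (MvPolynomial (Fin n) k) (Subgroup.zpowers σ))
            (MvPolynomial (Fin n) k))))
        ↥(Subgroup.zpowers σ))
      (_ : ρB.aut = (affineBlowup.isBlowup (I12 k n a b c d)).liftAction ρ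
        (idealSheaf_I12_comap k n a b c d hab hac had hbc hbd hcd σ (hσ a hab hac had hae) hb hc hd
          ρ hρ))
      (O₀ : ρB.StableAffineOpens) (_ : O₀.1 = chart k n a b c d 0)
      (hle : ((O₀.1.ι ≫ affineBlowup.π (I12 k n a b c d) ≫
          Spec.map (CommRingCat.ofHom (algebraMap
            (FixedPoints.subalgebra k (MvPolynomial (Fin n) k) (Subgroup.zpowers σ))
            (MvPolynomial (Fin n) k)))) ⁻¹ᵁ ⊤ : (O₀.1 : Scheme.{0}).Opens) ≤
        O₀.1.ι ⁻¹ᵁ chart k n a b c d 0)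
      (T : {j : Fin 40 // j ≠ 0 ∧ j ≠ 2 ∧ j ≠ 5 ∧ j ≠ 13} →
        Γ(affineBlowup (I12 k n a b c d), chart k n a b c d 0))
      (T' : {j : Fin 40 // j ≠ 0} → Γ(affineBlowup (I12 k n a b c d), chart k n a b c d 0))
      (_ : ∀ j, (affineBlowup.π (I12 k n a b c d)).appLE ⊤ (chart k n a b c d 0)
            (blowupChart_le_preimage _ _ _ _)
            ((Scheme.ΓSpecIso (CommRingCat.of (MvPolynomial (Fin n) k))).inv.hom
              (gens12 k n a b c d j.1)) =
          (affineBlowup.π (I12 k n a b c d)).appLE ⊤ (chart k n a b c d 0)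
            (blowupChart_le_preimage _ _ _ _)
            ((Scheme.ΓSpecIso (CommRingCat.of (MvPolynomial (Fin n) k))).inv.hom
              (gens12 k n a b c d 0)) * T j)
      (_ : ∀ j, (affineBlowup.π (I12 k n a b c d)).appLE ⊤ (chart k n a b c d 0)
            (blowupChart_le_preimage _ _ _ _)
            ((Scheme.ΓSpecIso (CommRingCat.of (MvPolynomial (Fin n) k))).inv.hom
              (gens12 k n a b c d j.1)) =
          (affineBlowup.π (I12 k n a b c d)).appLE ⊤ (chart k n a b c d 0)
            (blowupChart_le_preimage _ _ _ _)
            ((Scheme.ΓSpecIso (CommRingCat.of (MvPolynomial (Fin n) k))).inv.hom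
              (gens12 k n a b c d 0)) * T' j),
      ∃ (R₀ : Type) (_ : CommRing R₀) (_ : IsNoetherianRing R₀) (J₀ J₀' : Ideal R₀)
        (ψ : R₀ →+* Γ((O₀.1 : Scheme.{0}), (O₀.1.ι ≫ affineBlowup.π (I12 k n a b c d) ≫
          Spec.map (CommRingCat.ofHom (algebraMap
            (FixedPoints.subalgebra k (MvPolynomial (Fin n) k) (Subgroup.zpowers σ))
            (MvPolynomial (Fin n) k)))) ⁻¹ᵁ ⊤)),
        Function.Injective ψ ∧ ψ.range = (ρB.restrict O₀.1 O₀.2.1).invariantsRing ⊤ ∧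
        J₀.IsRadical ∧ J₀'.IsRadical ∧
        ((Ideal.span ((O₀.1.ι.appLE (chart k n a b c d 0)
            ((O₀.1.ι ≫ affineBlowup.π (I12 k n a b c d) ≫
              Spec.map (CommRingCat.ofHom (algebraMap
                (FixedPoints.subalgebra k (MvPolynomial (Fin n) k) (Subgroup.zpowers σ))
                (MvPolynomial (Fin n) k)))) ⁻¹ᵁ ⊤) hle) ''
          (((affineBlowup.π (I12 k n a b c d)).appLE ⊤ (chart k n a b c d 0)
              (blowupChart_le_preimage _ _ _ _)) ''
            ((Scheme.ΓSpecIso (CommRingCat.of (MvPolynomial (Fin n) k))).inv ''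
              {X a, X b, X c, X d}) ∪ Set.range T))).comap ψ).radical = J₀ ∧
        ((Ideal.span ((O₀.1.ι.appLE (chart k n a b c d 0)
            ((O₀.1.ι ≫ affineBlowup.π (I12 k n a b c d) ≫
              Spec.map (CommRingCat.ofHom (algebraMap
                (FixedPoints.subalgebra k (MvPolynomial (Fin n) k) (Subgroup.zpowers σ))
                (MvPolynomial (Fin n) k)))) ⁻¹ᵁ ⊤) hle) ''
          (((affineBlowup.π (I12 k n a b c d)).appLE ⊤ (chart k n a b c d 0)
              (blowupChart_le_preimage _ _ _ _)) ''
            ((Scheme.ΓSpecIso (CommRingCat.of (MvPolynomial (Fin n) k))).inv ''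
              {X a, X b, X c, X d}) ∪ Set.range T'))).comap ψ).radical = J₀' ∧
        Scheme.IsRegular (affineBlowup (J₀ * (J₀ ^ 2).colon (J₀' : Set R₀))) := by

  intro ρ hρ ρB haut O₀ hO₀ hle T T' hT hT'
  have Hseam := exists_sectionsEquiv_chart0_appLE k n σ a b c d e hab hac had hae hσ
    (smul_I12_eq k n a b c d hab hac had hbc hbd hcd σ (hσ a hab hac had hae) hb hc hd) ρ hρ _ ρB haut
    O₀ hO₀ hle
  rcases Hseam with ⟨φ, hP, Ω, hφ, hbase, -, hinv⟩
  exact BlowupExit.ringBrick_transport₂ _ _ _ _ Ω hbase _ _ hinv (gens12 k n a b c d 0) _ _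
    ({X a, X b, X c, X d} : Set (MvPolynomial (Fin n) k)) T T' hT hT'
    (fun t t' ht ht' => Hring₀ φ hφ hP t t' ht ht')

end Summit.ResolutionOfSingularities.ResolutionOfSingularities.Theorems.WildQuotientResolution.JordanFive

end
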